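import Mathlib
import HarnessLib
import HarnessLib.Audit
import Summits.AtomisticToContinuum.Statement
import Literature.Analysis.FluidPDE.HardSphereCollisionRecord
import Literature.MathematicalPhysics.KineticTheory.HardSphereEulerLLN

/-! # SplitChildren (strategist s1): the five children of the requested glued split of `ImplosionDichotomy.HydroLimitInBand` — EXACT TEXTS of children.json,
elaborated in the ROUTE-FILE context (imports = the route's mandatory four + the two Literature modules the children need;
namespace and `open` lines exactly as the gate renders them). -/

namespace Summit.AtomisticToContinuum.HydrodynamicLimit.Cruxes.HydroLimitInBand.SplitChildren

open scoped BigOperators Topology Manifold Classical MeasureTheory ProbabilityTheory Matrix InnerProductSpace ComplexConjugate ContinuousMap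
open Filter Set Function TopologicalSpace MeasureTheory

/-- child (split of HydroLimitInBand) -/
def KineticCurrentsLDAlongFamilies : Prop :=
  ∃ η₀ : ℝ, 0 < η₀ ∧ ∀ (t₁ : ℝ) (a θ₀ : ℝ → Literature.MathematicalPhysics.KineticTheory.T3 → ℝ) (u₀ : ℝ → Literature.MathematicalPhysics.KineticTheory.T3 → Literature.MathematicalPhysics.KineticTheory.V3), Continuous (Function.uncurry a) → Continuous (Function.uncurry θ₀) → Continuous (Function.uncurry u₀) → (∀ s x, 0 < a s x) → (∀ s x, 0 < θ₀ s x) → ∀ σ : ℝ, 0 < σ → (∀ s ∈ Set.Icc 0 t₁, σ ^ 3 * (⨆ x, a s x) ≤ η₀ * ∫ x, a s x) → ∀ Φ : (N : ℕ) → Literature.Analysis.FluidPDE.HardSphereFlow (Literature.Analysis.FluidPDE.Torus.geometry (Fin 3)) (Literature.MathematicalPhysics.KineticTheory.hsDiameter σ N) (N + 1), ∀ (A : ℝ → Literature.MathematicalPhysics.KineticTheory.T3 → Fin 3 → Fin 3 → ℝ) (b : ℝ → Literature.MathematicalPhysics.KineticTheory.T3 → Literature.MathematicalPhysics.KineticTheory.V3)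 (G : ℝ → Literature.MathematicalPhysics.KineticTheory.T3 × ℝ → ℝ), Continuous (Function.uncurry A) → Continuous (Function.uncurry b) → Continuous (Function.uncurry G) → (let F := fun (s : ℝ) (y : Literature.MathematicalPhysics.KineticTheory.T3 × Literature.MathematicalPhysics.KineticTheory.V3) => (∑ j : Fin 3, ∑ k : Fin 3, A s y.1 j k * ((y.2 - u₀ s y.1) j * (y.2 - u₀ s y.1) k)) + (∑ j : Fin 3, b s y.1 j * (y.2 - u₀ s y.1) j) * G s (y.1, ‖y.2 - u₀ s y.1‖ ^ 2); (∃ C : ℝ, ∀ s ∈ Set.Icc 0 t₁, ∀ y : Literature.MathematicalPhysics.KineticTheory.T3 × Literature.MathematicalPhysics.KineticTheory.V3, |F s y| ≤ C * (1 + ‖y.2‖ ^ 2)) → (∀ s ∈ Set.Icc 0 t₁, ∀ x, ∫ v, F s (x, v) * Literature.Analysis.FluidPDE.localMaxwellian 1 (θ₀ s x) (u₀ s x) v = 0) → (∀ s ∈ Set.Icc 0 t₁, ∀ x (j : Fin 3), ∫ v, F s (x, v) * v j * Literature.Analysis.FluidPDE.localMaxwellian 1 (θ₀ s x) (u₀ s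 x) v = 0) → (∀ s ∈ Set.Icc 0 t₁, ∀ x, ∫ v, F s (x, v) * ‖v‖ ^ 2 * Literature.Analysis.FluidPDE.localMaxwellian 1 (θ₀ s x) (u₀ s x) v = 0) → ∃ β₀ : ℝ, 0 < β₀ ∧ ∀ β : ℝ, |β| ≤ β₀ → ∀ ε : ℝ, 0 < ε → ∃ τ₀ : ℝ, 0 < τ₀ ∧ ∀ τ : ℝ, τ₀ ≤ τ → ∃ N₀ : ℕ, ∀ N : ℕ, N₀ ≤ N → ∀ s ∈ Set.Icc 0 t₁, ∫⁻ z, ENNReal.ofReal (Real.exp (β * ∑ i : Fin (N + 1), (τ * ((N : ℝ) + 1) ^ (-(1 / 3 : ℝ)))⁻¹ * ∫ r in (0 : ℝ)..(τ * ((N : ℝ) + 1) ^ (-(1 / 3 : ℝ))), F s ((Φ N).flow r z i))) ∂(Literature.MathematicalPhysics.KineticTheory.localGibbsLaw σ (a s) (u₀ s) (θ₀ s) N (Φ N)) ≤ ENNReal.ofReal (Real.exp (ε * ((N : ℝ) + 1))))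

/-- child (split of HydroLimitInBand) -/
def LocalClampedTransferWindowLDFamily : Prop :=
  ∃ η₀ : ℝ, 0 < η₀ ∧ ∀ (t₁ : ℝ) (a θ₀ : ℝ → Literature.MathematicalPhysics.KineticTheory.T3 → ℝ) (u₀ : ℝ → Literature.MathematicalPhysics.KineticTheory.T3 → Literature.MathematicalPhysics.KineticTheory.V3) (ha : ∀ s, Continuous (a s)), Continuous (Function.uncurry a) → Continuous (Function.uncurry θ₀) → Continuous (Function.uncurry u₀) → ∀ (ha0 : ∀ s x, 0 < a s x), (∀ s x, 0 < θ₀ s x) → ∀ σ : ℝ, 0 < σ → σ < 1 / 2 → (∀ s ∈ Set.Icc 0 t₁, σ ^ 3 * (⨆ x, a s x) ≤ η₀ * ∫ x, a s x) → ∀ Φ : (N : ℕ) → Literature.Analysis.FluidPDE.HardSphereFlow (Literature.Analysis.FluidPDE.Torus.geometry (Fin 3)) (Literature.MathematicalPhysics.KineticTheory.hsDiameter σ N) (N + 1), ∀ φ : ℝ → Literature.MathematicalPhysics.KineticTheory.T3 → ℝ, Literature.Analysis.FunctionSpaces.Torus.IsSmoothSpaceTimeOn (Set.Icc 0 t₁)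 φ → ∃ V₀ : ℝ, 0 < V₀ ∧ ∀ V : ℝ, V₀ ≤ V → ∃ β₀ : ℝ, 0 < β₀ ∧ ∀ β : ℝ, |β| ≤ β₀ → ∀ ε : ℝ, 0 < ε → ∃ τ₀ : ℝ, 0 < τ₀ ∧ ∀ τ : ℝ, τ₀ ≤ τ → ∃ N₀ : ℕ, ∀ N : ℕ, N₀ ≤ N → ∀ s ∈ Set.Icc 0 t₁, (let ρ₀ : Literature.MathematicalPhysics.KineticTheory.T3 → ℝ := Literature.MathematicalPhysics.KineticTheory.rhoLim (Literature.MathematicalPhysics.KineticTheory.profileOf (a s) (ha s) (ha0 s)) σ; let w : ℝ := τ * ((N : ℝ) + 1) ^ (-(1 / 3 : ℝ)); let P := Literature.MathematicalPhysics.KineticTheory.localGibbsLaw σ (a s) (u₀ s) (θ₀ s) N (Φ N); let Z : Literature.MathematicalPhysics.KineticTheory.T3 → ℝ := fun x => Literature.MathematicalPhysics.KineticTheory.hsCompressibility (ρ₀ x * σ ^ 3); let Z' : Literature.MathematicalPhysics.KineticTheory.T3 → ℝ := fun x => deriv Literature.MathematicalPhysics.KineticTheory.hsCompressibility (ρ₀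 x * σ ^ 3); let act := fun (i : Fin (N + 1)) z => σ / τ * (Φ N).collisionSum (Set.Ioc 0 w) (fun c => if c.fst = i then ‖c.postVel.1 - c.preVel.1‖ + |‖c.postVel.1‖ ^ 2 - ‖c.preVel.1‖ ^ 2| / 2 else 0) z; let ω := fun (i : Fin (N + 1)) z => if act i z ≤ V then (1 : ℝ) else 0; let Xm := fun (k : Fin 3) z => (Φ N).collisionSum (Set.Ioc 0 w) (fun c => ω c.fst z * ω c.snd z * ((φ s c.fstPos - φ s c.sndPos) * (c.postVel.1 k - c.preVel.1 k)) / 2) z; let Am := fun (k : Fin 3) z => (∫ r in (0 : ℝ)..w, ∑ i : Fin (N + 1), Literature.Analysis.FunctionSpaces.Torus.partialDeriv k (φ s) ((Φ N).flow r z i).1 * (θ₀ s ((Φ N).flow r z i).1 * (ρ₀ ((Φ N).flow r z i).1 * σ ^ 3) * Z' ((Φ N).flow r z i).1 + (1 / 3) * (Z ((Φ N).flow r z i).1 - 1) * ‖((Φ N).flow r z i).2 - u₀ s ((Φ N).flow r z i).1‖ ^ 2)) - w * ((N : ℝ) + 1) * ∫ x, ρ₀ x * Literature.Analysis.FunctionSpaces.Torus.partialDeriv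 k (φ s) x * (θ₀ s x * (ρ₀ x * σ ^ 3) * Z' x); let Xe := fun z => (Φ N).collisionSum (Set.Ioc 0 w) (fun c => ω c.fst z * ω c.snd z * ((φ s c.fstPos - φ s c.sndPos) * ((‖c.postVel.1‖ ^ 2 - ‖c.preVel.1‖ ^ 2) / 2)) / 2) z; let Ae := fun z => (∫ r in (0 : ℝ)..w, ∑ i : Fin (N + 1), ((∑ l : Fin 3, u₀ s ((Φ N).flow r z i).1 l * Literature.Analysis.FunctionSpaces.Torus.partialDeriv l (φ s) ((Φ N).flow r z i).1) * (θ₀ s ((Φ N).flow r z i).1 * (ρ₀ ((Φ N).flow r z i).1 * σ ^ 3) * Z' ((Φ N).flow r z i).1 + (1 / 3) * (Z ((Φ N).flow r z i).1 - 1) * ‖((Φ N).flow r z i).2 - u₀ s ((Φ N).flow r z i).1‖ ^ 2) + θ₀ s ((Φ N).flow r z i).1 * (Z ((Φ N).flow r z i).1 - 1) * (∑ l : Fin 3, Literature.Analysis.FunctionSpaces.Torus.partialDeriv l (φ s) ((Φ N).flow r z i).1 * (((Φ N).flow r z i).2 - u₀ s ((Φ N).flow r z i).1) l))) - w * ((N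 : ℝ) + 1) * ∫ x, ρ₀ x * (∑ l : Fin 3, u₀ s x l * Literature.Analysis.FunctionSpaces.Torus.partialDeriv l (φ s) x) * (θ₀ s x * (ρ₀ x * σ ^ 3) * Z' x); (∀ k : Fin 3, ∫⁻ z, ENNReal.ofReal (Real.exp (β * (w⁻¹ * Xm k z - w⁻¹ * Am k z))) ∂P ≤ ENNReal.ofReal (Real.exp (ε * ((N : ℝ) + 1)))) ∧ ∫⁻ z, ENNReal.ofReal (Real.exp (β * (w⁻¹ * Xe z - w⁻¹ * Ae z))) ∂P ≤ ENNReal.ofReal (Real.exp (ε * ((N : ℝ) + 1))))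

/-- child (split of HydroLimitInBand) -/
def CoherentSuprathermalContentVanishesW : Prop :=
  ∀ (a₀ θ₀ : Literature.MathematicalPhysics.KineticTheory.T3 → ℝ) (u₀ : Literature.MathematicalPhysics.KineticTheory.T3 → Literature.MathematicalPhysics.KineticTheory.V3), Continuous a₀ → Continuous θ₀ → Continuous u₀ → (∀ x, 0 < a₀ x) → (∀ x, 0 < θ₀ x) → ∃ σ₀ : ℝ, 0 < σ₀ ∧ ∀ σ : ℝ, 0 < σ → σ < σ₀ → ∀ (T : ℝ) (ρ θ : ℝ → Literature.MathematicalPhysics.KineticTheory.T3 → ℝ) (u : ℝ → Literature.MathematicalPhysics.KineticTheory.T3 → Literature.MathematicalPhysics.KineticTheory.V3), Literature.MathematicalPhysics.KineticTheory.IsHardSphereEulerSolution σ T ρ u θ → ∀ Φ : (N : ℕ) → Literature.Analysis.FluidPDE.HardSphereFlow (Literature.Analysis.FluidPDE.Torus.geometry (Fin 3)) (Literature.MathematicalPhysics.KineticTheory.hsDiameter σ N) (N + 1), Literature.MathematicalPhysics.KineticTheory.TendstoHydroFieldsAt (fun N => Literature.MathematicalPhysics.KineticTheory.localGibbsLaw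 σ a₀ u₀ θ₀ N (Φ N)) Φ ρ u θ 0 → ∀ t ∈ Set.Ico 0 T, ∃ Kstar : ℝ, 0 < Kstar ∧ ∀ R : ℝ → Literature.MathematicalPhysics.KineticTheory.T3 → ℝ → ℝ, Measurable (fun p : ℝ × Literature.MathematicalPhysics.KineticTheory.T3 × ℝ => R p.1 p.2.1 p.2.2) → (∀ s x s', s' ≤ Kstar ^ 2 → R s x s' = 0) → (∀ s x s', |R s x s'| ≤ |s'|) → ∀ η : ℝ, 0 < η → ∀ ε : ℝ, 0 < ε → ∃ τ₀ : ℝ, 0 < τ₀ ∧ ∀ τ : ℝ, τ₀ ≤ τ → ∃ N₀ : ℕ, ∀ N : ℕ, N₀ ≤ N → ∀ s ∈ Set.Icc 0 t, (let w : ℝ := τ * ((N : ℝ) + 1) ^ (-(1 / 3 : ℝ)); let P := Literature.MathematicalPhysics.KineticTheory.localGibbsLaw σ a₀ u₀ θ₀ N (Φ N); let W := fun (i : Fin (N + 1)) (s r : ℝ) (z : Literature.Analysis.FluidPDE.Config (N + 1) (Fin 3) Literature.MathematicalPhysics.KineticTheory.T3) => ((Φ N).flow r z i).2 - u s ((Φ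 N).flow r z i).1; let cub := fun (i : Fin (N + 1)) (s : ℝ) (z : Literature.Analysis.FluidPDE.Config (N + 1) (Fin 3) Literature.MathematicalPhysics.KineticTheory.T3) => w⁻¹ * ∫ r in s..(s + w), ‖W i s r z‖ ^ 3; let cubHi := fun (i : Fin (N + 1)) (s : ℝ) (z : Literature.Analysis.FluidPDE.Config (N + 1) (Fin 3) Literature.MathematicalPhysics.KineticTheory.T3) => w⁻¹ * ∫ r in s..(s + w), (if Kstar < ‖W i s r z‖ then ‖W i s r z‖ ^ 3 else 0); let qbar := fun (i : Fin (N + 1)) (s : ℝ) (z : Literature.Analysis.FluidPDE.Config (N + 1) (Fin 3) Literature.MathematicalPhysics.KineticTheory.T3) => w⁻¹ • ∫ r in s..(s + w), (R s ((Φ N).flow r z i).1 (‖W i s r z‖ ^ 2)) • W i s r z; ∫⁻ z, ENNReal.ofReal (((N : ℝ) + 1)⁻¹ * ∑ i : Fin (N + 1), (if η * cub i s z < ‖qbar i s z‖ then cubHi i s z else 0)) ∂P ≤ ENNReal.ofReal ε)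

/-- child (split of HydroLimitInBand) -/
def TransferActivityTails : Prop :=
  ∀ (a₀ θ₀ : Literature.MathematicalPhysics.KineticTheory.T3 → ℝ) (u₀ : Literature.MathematicalPhysics.KineticTheory.T3 → Literature.MathematicalPhysics.KineticTheory.V3), Continuous a₀ → Continuous θ₀ → Continuous u₀ → (∀ x, 0 < a₀ x) → (∀ x, 0 < θ₀ x) → ∃ σ₀ : ℝ, 0 < σ₀ ∧ ∀ σ : ℝ, 0 < σ → σ < σ₀ → ∀ (T : ℝ) (ρ θ : ℝ → Literature.MathematicalPhysics.KineticTheory.T3 → ℝ) (u : ℝ → Literature.MathematicalPhysics.KineticTheory.T3 → Literature.MathematicalPhysics.KineticTheory.V3), Literature.MathematicalPhysics.KineticTheory.IsHardSphereEulerSolution σ T ρ u θ → ∀ Φ : (N : ℕ) → Literature.Analysis.FluidPDE.HardSphereFlow (Literature.Analysis.FluidPDE.Torus.geometry (Fin 3)) (Literature.MathematicalPhysics.KineticTheory.hsDiameter σ N) (N + 1), Literature.MathematicalPhysics.KineticTheory.TendstoHydroFieldsAt (fun N => Literature.MathematicalPhysics.KineticTheory.localGibbsLaw σ a₀ u₀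 θ₀ N (Φ N)) Φ ρ u θ 0 → ∀ t ∈ Set.Ico 0 T, ∃ V₀ : ℝ, 0 < V₀ ∧ ∀ V : ℝ, V₀ ≤ V → ∀ ε : ℝ, 0 < ε → ∃ τ₀ : ℝ, 0 < τ₀ ∧ ∀ τ : ℝ, τ₀ ≤ τ → ∃ N₀ : ℕ, ∀ N : ℕ, N₀ ≤ N → ∀ s ∈ Set.Icc 0 t, (let w : ℝ := τ * ((N : ℝ) + 1) ^ (-(1 / 3 : ℝ)); let P := Literature.MathematicalPhysics.KineticTheory.localGibbsLaw σ a₀ u₀ θ₀ N (Φ N); let act := fun (i : Fin (N + 1)) (z : Literature.Analysis.FluidPDE.Config (N + 1) (Fin 3) Literature.MathematicalPhysics.KineticTheory.T3) => σ / τ * (Φ N).collisionSum (Set.Ioc s (s + w)) (fun c => if c.fst = i then ‖c.postVel.1 - c.preVel.1‖ + |‖c.postVel.1‖ ^ 2 - ‖c.preVel.1‖ ^ 2| / 2 else 0) z; ∫⁻ z, ENNReal.ofReal (((N : ℝ) + 1)⁻¹ * ∑ i : Fin (N + 1), Set.indicator {y : ℝ | V < y} (fun y => y) (act i z)) ∂P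 ≤ ENNReal.ofReal ε)

/-- child (split of HydroLimitInBand) -/
def EnergyCurrentTails : Prop :=
  ∀ (a₀ θ₀ : Literature.MathematicalPhysics.KineticTheory.T3 → ℝ) (u₀ : Literature.MathematicalPhysics.KineticTheory.T3 → Literature.MathematicalPhysics.KineticTheory.V3), Continuous a₀ → Continuous θ₀ → Continuous u₀ → (∀ x, 0 < a₀ x) → (∀ x, 0 < θ₀ x) → ∃ σ₀ : ℝ, 0 < σ₀ ∧ ∀ σ : ℝ, 0 < σ → σ < σ₀ → ∀ (T : ℝ) (ρ θ : ℝ → Literature.MathematicalPhysics.KineticTheory.T3 → ℝ) (u : ℝ → Literature.MathematicalPhysics.KineticTheory.T3 → Literature.MathematicalPhysics.KineticTheory.V3), Literature.MathematicalPhysics.KineticTheory.IsHardSphereEulerSolution σ T ρ u θ → ∀ Φ : (N : ℕ) → Literature.Analysis.FluidPDE.HardSphereFlow (Literature.Analysis.FluidPDE.Torus.geometry (Fin 3)) (Literature.MathematicalPhysics.KineticTheory.hsDiameter σ N) (N + 1), Literature.MathematicalPhysics.KineticTheory.TendstoHydroFieldsAt (fun N => Literature.MathematicalPhysics.KineticTheory.localGibbsLaw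 σ a₀ u₀ θ₀ N (Φ N)) Φ ρ u θ 0 → ∀ t ∈ Set.Ico 0 T, ∀ ε : ℝ, 0 < ε → ∃ M : ℝ, ∃ N₀ : ℕ, ∀ N : ℕ, N₀ ≤ N → ∀ s ∈ Set.Icc 0 t, ∫⁻ z, ENNReal.ofReal (((N : ℝ) + 1)⁻¹ * ∑ i : Fin (N + 1), Set.indicator {v : Literature.MathematicalPhysics.KineticTheory.V3 | M < ‖v‖} (fun v => ‖v‖ ^ 3) (((Φ N).flow s z i).2)) ∂(Literature.MathematicalPhysics.KineticTheory.localGibbsLaw σ a₀ u₀ θ₀ N (Φ N)) ≤ ENNReal.ofReal ε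

end Summit.AtomisticToContinuum.HydrodynamicLimit.Cruxes.HydroLimitInBand.SplitChildren
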